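import Literature.Computability.Complexity.SymmetricColourRefinementSymmetry
import Summits.PneNP.PneNP.Theorems.SymmetryBudgetWindowCanoniserActBuilders

/-!
# Window canoniser, X′: relabelling of wires, index permutations and formers (toward symmetry)

Route `PneNP/SymmetryBudget`, dichotomy `WindowBarrier` (stmt-PneNP-2145) / `NoHiddenOrder` (stmt-PneNP-14781);
continuation of `…WindowCanoniserActBuilders.lean`.  The relabelling `WCan.F π` of wires induced by a window
permutation, the induced permutations of pair / product / subset indices, counters and two-block tuples under
relabelling, and the relabelling of the remaining wiring formers (adjacency literals, `iffF`, `WEF`, `rkF`, `EQF`,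
`nonbotF`, `iLTW`, `reach0W`, child labels, `lbitA`, `pvecA`, `leafBitW`).  The symmetry theorem is in
`…Symmetry.lean`.
-/

-- `Summit.PneNP.PneNP.…` duplicates `PneNP` BY DESIGN (single-problem summit, D-0017 layout).
set_option linter.dupNamespace false

noncomputable section

namespace Summit.PneNP.PneNP.Theorems

namespace WCan

open Finset Equiv Literature.Computability.Complexity Literature.Computability.Complexity.SymCR

variable {K r n : ℕ} (π : Perm (Fin n))

/-! ### The relabelling of wires -/

/-- The input map of `π`: diagonal action of `extPerm π`. -/
abbrev dg (π : Perm (Fin n)) : Perm (Fin (r + n) × Fin (r + n)) := Equiv.prodCongr (extPerm r π) (extPerm r π)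

/-- The relabelling of wires induced by `π`. -/
abbrev F (π : Perm (Fin n)) : Wire K r n → Wire K r n := Sum.map (dg π) (Node.act π)

/-- `F_inl`: bookkeeping/simp lemma (F inl). -/
@[simp] theorem F_inl (q : Fin (r + n) × Fin (r + n)) : F (K := K) π (Sum.inl q) = Sum.inl (extPerm r π q.1, extPerm r π q.2) := rfl
/-- `F_wA`: bookkeeping/simp lemma (F wA). -/
@[simp] theorem F_wA (a : Atom K r n) : F π (wA a) = wA (a.act π) := rfl
/-- `F_wN`: bookkeeping/simp lemma (F wN). -/
@[simp] theorem F_wN (a : Atom K r n) : F π (wN a) = wN (a.act π) := rfl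
/-- `F_w1`: bookkeeping/simp lemma (F w1). -/
@[simp] theorem F_w1 (f : N1 K r n) : F π (w1 f) = w1 (f.act π) := rfl
/-- `F_w2`: bookkeeping/simp lemma (F w2). -/
@[simp] theorem F_w2 (f : N2 K r n) : F π (w2 f) = w2 (f.act π) := rfl

/-- `wire_litAct`: bookkeeping/simp lemma (wire litAct). -/
theorem wire_litAct (l : Lit K r n) : (litAct π l).wire = F π l.wire := by
  unfold Lit.wire litAct; rcases l with ⟨a, _ | _⟩ <;> rfl

/-! ### Index permutations -/

/-- Product of permutations on `Fin (a * b)` through `finProdFinEquiv`. -/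
def pp {a b : ℕ} (σ : Perm (Fin a)) (τ : Perm (Fin b)) : Perm (Fin (a * b)) :=
  finProdFinEquiv.symm.trans ((Equiv.prodCongr σ τ).trans finProdFinEquiv)

/-- `symm_pp`: bookkeeping/simp lemma (symm pp). -/
theorem symm_pp {a b : ℕ} (σ : Perm (Fin a)) (τ : Perm (Fin b)) (i : Fin (a * b)) :
    finProdFinEquiv.symm (pp σ τ i) = (σ (finProdFinEquiv.symm i).1, τ (finProdFinEquiv.symm i).2) := by
  simp [pp]

/-- `divNat_pp`: bookkeeping/simp lemma (divNat pp). -/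
@[simp] theorem divNat_pp {a b : ℕ} (σ : Perm (Fin a)) (τ : Perm (Fin b)) (i : Fin (a * b)) :
    (pp σ τ i).divNat = σ i.divNat := by
  have := congrArg Prod.fst (symm_pp σ τ i)
  simpa using this

/-- `modNat_pp`: bookkeeping/simp lemma (modNat pp). -/
@[simp] theorem modNat_pp {a b : ℕ} (σ : Perm (Fin a)) (τ : Perm (Fin b)) (i : Fin (a * b)) :
    (pp σ τ i).modNat = τ i.modNat := by
  have := congrArg Prod.snd (symm_pp σ τ i)
  simpa using this

/-- The permutation of subset indices induced by `π`. -/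
def fsP (π : Perm (Fin n)) : Perm (Fin (2 ^ n)) := (fsEnum n).trans ((Equiv.finsetCongr π).trans (fsEnum n).symm)

/-- `fsEnum_fsP`: bookkeeping/simp lemma (fsEnum fsP). -/
@[simp] theorem fsEnum_fsP (e : Fin (2 ^ n)) : fsEnum n (fsP π e) = (fsEnum n e).map π.toEmbedding := by
  simp [fsP, Equiv.finsetCongr_apply]

/-- Counters: relabelling the counted wires re-indexes the counter (padding is fixed). -/
theorem F_cnt {N θ : ℕ} {ws ws' : Fin N → Wire K r n} (τ : Perm (Fin N)) (h : ∀ a, F π (ws a) = ws' (τ a))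
    (k : Fin (N + N)) : F π (cnt N θ ws k) = cnt N θ ws' (blockPerm τ 1 k) := by
  unfold cnt
  rw [append_blockPerm]
  induction k using Fin.addCases with
  | left i => simp only [Fin.append_left, Function.comp_apply, h]
  | right j =>
    simp only [Fin.append_right, Function.comp_apply, Perm.coe_one, id_eq]
    split_ifs <;> rfl

/-- Two-block tuples. -/
theorem F_append {N M : ℕ} {f f' : Fin N → Wire K r n} {g g' : Fin M → Wire K r n} (τ : Perm (Fin N))
    (σ : Perm (Fin M)) (hf : ∀ a, F π (f a) = f' (τ a)) (hg : ∀ a, F π (g a) = g' (σ a)) (k : Fin (N + M)) :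
    F π (Fin.append f g k) = Fin.append f' g' (blockPerm τ σ k) := by
  rw [append_blockPerm]
  induction k using Fin.addCases with
  | left i => simp only [Fin.append_left, Function.comp_apply, hf]
  | right j => simp only [Fin.append_right, Function.comp_apply, hg]

/-! ### Relabelling the remaining formers -/

section Formers

variable [NeZero n] (L : Lab K n)

/-- `litAct_adjLit`: bookkeeping/simp lemma (litAct adjLit). -/
@[simp] theorem litAct_adjLit (u v : Fin n) : litAct π (adjLit (K := K) (r := r) u v) = adjLit (π u) (π v) := by
  unfold adjLit; by_cases h : u = v <;> simp [h]

/-- `litAct_nadjLit`: bookkeeping/simp lemma (litAct nadjLit). -/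
@[simp] theorem litAct_nadjLit (u v : Fin n) : litAct π (nadjLit (K := K) (r := r) u v) = nadjLit (π u) (π v) := by
  unfold nadjLit; by_cases h : u = v <;> simp [h]

omit [NeZero n] in
/-- `act_litN1`: bookkeeping/simp lemma (act litN1). -/
@[simp] theorem act_litN1 (l : Lit K r n) : (litN1 l).act π = litN1 (litAct π l) := by simp [litN1]

omit [NeZero n] in
/-- `act_iffF`: bookkeeping/simp lemma (act iffF). -/
@[simp] theorem act_iffF (a b : Atom K r n) : (iffF a b).act π = iffF (a.act π) (b.act π) := by simp [iffF]

/-- `act_WEF`: bookkeeping/simp lemma (act WEF). -/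
@[simp] theorem act_WEF (it : Fin (T n + 1)) (v y : Fin n) : (WEF (r := r) L it v y).act π = WEF (L.act π) it (π v) (π y) := by
  simp [WEF]

/-- `act_nWEF`: bookkeeping/simp lemma (act nWEF). -/
@[simp] theorem act_nWEF (it : Fin (T n + 1)) (v y : Fin n) : (nWEF (r := r) L it v y).act π = nWEF (L.act π) it (π v) (π y) := by
  simp [nWEF]

/-- `act_rkF`: bookkeeping/simp lemma (act rkF). -/
@[simp] theorem act_rkF (Lx : Lab K n) (w j : Fin n) : (rkF (r := r) Lx w j).act π = rkF (Lx.act π) (π w) j := by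
  simp [rkF]

/-- `act_EQF`: bookkeeping/simp lemma (act EQF). -/
@[simp] theorem act_EQF (Lx : Lab K n) (a b : Fin n) : (EQF (r := r) Lx a b).act π = EQF (Lx.act π) (π a) (π b) := by
  simp [EQF]

/-- `act_nonbotF`: bookkeeping/simp lemma (act nonbotF). -/
@[simp] theorem act_nonbotF (Lc : Lab K n) (z : Fin n) : (nonbotF (r := r) Lc z).act π = nonbotF (Lc.act π) (π z) := by
  unfold nonbotF
  simp only [Lab.act_val, RawLab.card_act_U]
  split_ifs <;> simp

/-- `F_iLTW`: bookkeeping/simp lemma (F iLTW). -/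
theorem F_iLTW (it : Fin (T n + 1)) (u w : Fin n) : F π (iLTW (r := r) L it u w) = iLTW (L.act π) it (π u) (π w) := by
  unfold iLTW
  by_cases h : u = w
  · subst h; simp
  · simp [h, π.injective.ne h]

/-- `F_reach0W`: bookkeeping/simp lemma (F reach0W). -/
theorem F_reach0W (it : Fin (T n + 1)) (u y : Fin n) : F π (reach0W (r := r) L it u y) = reach0W (L.act π) it (π u) (π y) := by
  unfold reach0W
  by_cases h : u = y
  · subst h; simp
  · simp [h, π.injective.ne h]

omit [NeZero n] in
/-- Candidate children are relabelled. -/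
theorem candLab_act (x : Fin n) (h : Fin (n + 1)) :
    candLab (L.act π) (π x) h = (candLab L x h).map (Lab.act π) := by
  unfold candLab
  have hc : (L.act π).1.cand (π x) h = (L.1.cand x h).act π := by rw [Lab.act_val, RawLab.act_cand]
  have hx : (π x ∉ (L.act π).1.X) ↔ x ∉ L.1.X := by simp
  have ha : (L.act π).1.cand (π x) h ∈ RawLab.admSet K n ↔ L.1.cand x h ∈ RawLab.admSet K n := by
    rw [hc, RawLab.act_mem_admSet_iff]
  by_cases h1 : x ∉ L.1.X ∧ L.1.cand x h ∈ RawLab.admSet K n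
  · rw [dif_pos h1, dif_pos (by rwa [hx, ha])]
    simp only [Option.map_some, Option.some.injEq]
    exact Subtype.ext hc
  · rw [dif_neg h1, dif_neg (by rwa [hx, ha])]
    rfl

omit [NeZero n] in
/-- Part children are relabelled. -/
theorem partLab_act (U' : Finset (Fin n)) :
    partLab (L.act π) (U'.map π.toEmbedding) = (partLab L U').map (Lab.act π) := by
  unfold partLab
  have hc : (U'.map π.toEmbedding ⊂ (L.act π).1.U ∧ (U'.map π.toEmbedding).Nonempty) ↔ (U' ⊂ L.1.U ∧ U'.Nonempty) := by
    simp [Finset.map_ssubset_map]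
  by_cases h1 : U' ⊂ L.1.U ∧ U'.Nonempty
  · rw [if_pos h1, if_pos (hc.2 h1)]; rfl
  · rw [if_neg h1, if_neg (fun h => h1 (hc.1 h))]; rfl

omit [NeZero n] in
/-- Children are relabelled. -/
theorem chLab_act (P : Prm r n) : chLab (L.act π) (P.act π) = (chLab L P).map (Lab.act π) := by
  unfold chLab
  simp only [Prm.act_fl, Prm.act_us, Prm.act_vs, Prm.act_h1]
  split_ifs
  · exact partLab_act π L _
  · exact candLab_act π L _ _

/-- `act_lbitA`: bookkeeping/simp lemma (act lbitA). -/
@[simp] theorem act_lbitA (κ : Fin n × Fin (n + 1)) (i : Fin (NB r n)) :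
    (lbitA L κ i).act π = lbitA (L.act π) (π κ.1, κ.2) i := by
  unfold lbitA
  rw [candLab_act]
  split
  · simp
  all_goals cases candLab L κ.1 κ.2 <;> simp

/-- `act_pvecA`: bookkeeping/simp lemma (act pvecA). -/
@[simp] theorem act_pvecA (u : Fin n) (i : Fin (NBp r n)) : (pvecA L u i).act π = pvecA (L.act π) (π u) i := by
  unfold pvecA
  split
  · simp
  · split <;> simp

/-- `F_leafBitW`: bookkeeping/simp lemma (F leafBitW). -/
theorem F_leafBitW (i : Fin (NB r n)) : F π (leafBitW L i) = leafBitW (L.act π) i := by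
  unfold leafBitW
  have hcard : (L.act π).1.U.card = L.1.U.card := by simp
  by_cases h : L.1.U.card = 1
  · have h' : (L.act π).1.U.card = 1 := hcard.trans h
    rw [dif_pos h, dif_pos h']
    -- the chosen vertex of the relabelled singleton is the relabelled chosen vertex
    have hu := Classical.choose_spec (Finset.card_eq_one.1 h)
    have hu' := Classical.choose_spec (Finset.card_eq_one.1 h')
    set u₀ := Classical.choose (Finset.card_eq_one.1 h)
    set u₁ := Classical.choose (Finset.card_eq_one.1 h')
    have he : u₁ = π u₀ := by
      have : π u₀ ∈ (L.act π).1.U := by simp [hu]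
      rw [hu'] at this
      exact (Finset.mem_singleton.1 this).symm
    dsimp only
    split
    · rfl
    · split_ifs <;> simp [he]
    · split_ifs <;> rfl
  · rw [dif_neg h, dif_neg (fun h' => h (hcard.symm.trans h'))]
    rfl

end Formers

end WCan

end Summit.PneNP.PneNP.Theorems

end
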